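import Mathlib.MeasureTheory.Measure.Prod
import Mathlib.MeasureTheory.Measure.Real
import Mathlib.MeasureTheory.Measure.Portmanteau
import Mathlib.Algebra.BigOperators.Field
import Mathlib.Algebra.Module.BigOperators
import HarnessLib

/-!
# Couplings along finite partitions and the coupling form of weak convergence

Topic `Literature/Probability/Distributions` (general measure theory; everything is proved, no
named fact is introduced). The coupling characterisation of weak convergence / of the
Lévy–Prokhorov distance (V. Strassen, Ann. Math. Statist. 36 (1965), Thm 11; R. M. Dudley,
*Real Analysis and Probability* (2002), Thm 11.6.2 and Cor. 11.6.4; T. Lindvall, *Lectures on the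
coupling method* (1992), §I.5) rests, in its elementary form, on one explicit construction: given
two probability measures and a finite measurable partition of each space into corresponding
cells, couple them so that the two coordinates fall into corresponding cells with the maximal
possible probability `Σ_j min (μ(A_j), ν(B_j))`. Applied to fine partitions into continuity
sets of a weak limit, this turns `μ_i ⇒ μ` into couplings under which the two coordinates are
`η`-close off an event of small probability — the form in which scaling limits stated as
convergence in law (e.g. the Camia–Newman loop ensemble, `Literature.Probability.Percolation.
exists_isCNLFamily_tendsto`, on the non-separable emetric space `LoopSpace ℂ`, where only
compact sets carry the argument) feed statements written in a coupling distance (DKKMO's `d_CN`,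
`Literature.Probability.RandomPlanarGeometry.LoopConfig.cnLawEDist`; target
`Literature.Probability.Percolation.exists_isFullPlaneCNLLaw`).

* `diagCouplingMatrix p q` — **the `γ`-coupling of two probability vectors** on a finite index set
  (Lindvall 1992, §I.5): `γ_{j j'} = δ_{j j'} m_j + (p_j - m_j)(q_{j'} - m_{j'}) / r` with
  `m_j = min (p_j, q_j)` and total leftover `r = Σ (p - m) = Σ (q - m)` (`r = 0`: diagonal).
  Proved: nonnegativity, row sums `p_j` and column sums `q_{j'}`
  (`sum_diagCouplingMatrix_right/left`), diagonal `≥ m_j` (`min_le_diagCouplingMatrix_self`), entries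
  `≤ p_j`, `≤ q_{j'}`.
* `partitionCoupling μ ν A B` — **the coupling of `μ` and `ν` along the partitions `A`, `B`**:
  the mixture `Σ_{j j'} γ_{j j'} · μ(· | A_j) ⊗ ν(· | B_{j'})` of the conditional product laws,
  written with restrictions and the weights `γ_{j j'} μ(A_j)⁻¹ ν(B_{j'})⁻¹` (cells of mass zero
  drop out: `γ_{j j'} ≤ p_j, q_{j'}`). Proved: marginals `μ` and `ν`
  (`map_fst_partitionCoupling`, `map_snd_partitionCoupling`: termwise push-forward of the finite
  sum, `Measure.map_fst_prod`, the row/column sums, and `μ = Σ_j μ|_{A_j}` for a partition),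
  probability measure, and **the diagonal blocks carry at least the common mass**
  (`le_partitionCoupling_iUnion_prod`: the `(j, j)` term alone gives `γ_{j j} ≥ m_j` on
  `A_j × B_j`); packaged as `exists_coupling_of_partition` (`π((⋃_j A_j × B_j)ᶜ) ≤
  1 - Σ_j min (μ(A_j), ν(B_j))`) and its `ℝ≥0∞` form `exists_coupling_of_partition'`.
* `exists_fine_nullFrontier_partition` — on a pseudo-emetric space, for a finite measure `μ`, a
  compact `K` and `η > 0`: finitely many disjoint measurable cells of edistance-diameter `< η`
  covering `K` with `μ`-null frontiers (disjointified finite subcover of `K` by null-frontier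
  thickenings of points, `exists_null_frontier_thickening'`, the emetric version of Mathlib's
  lemma; frontier bookkeeping `frontier_biUnion_lt_subset`, `frontier_disjointed_subset`).
* `exists_coupling_of_tendsto_of_isCompact` — **the coupling form of weak convergence**: if
  `μ_i ⇒ μ` (Mathlib's topology on `ProbabilityMeasure`), then for every compact `K` and `η > 0`,
  eventually there is a coupling `π_i` of `μ_i` and `μ` with
  `π_i(edist ≥ η) ≤ 2 μ(Kᶜ) + η` (portmanteau for the continuity cells,
  `ProbabilityMeasure.tendsto_measure_of_null_frontier_of_tendsto'`, then the partition coupling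
  with the remainder cell); `exists_coupling_of_tendsto_of_le_compact`: `≤ 3η` when
  `μ(Kᶜ) ≤ η` (tight limits).

## References

* V. Strassen, *The existence of probability measures with given marginals*, Ann. Math. Statist.
  36 (1965) 423–439, Thm 11 [Strassen1965].
* R. M. Dudley, *Real Analysis and Probability*, Cambridge Univ. Press (2002), §11.6
  (Thm 11.6.2, Cor. 11.6.4: Prokhorov distance and couplings).
* T. Lindvall, *Lectures on the Coupling Method*, Wiley (1992), §I.5 (the `γ`-coupling; maximal
  coupling of discrete distributions).
* P. Billingsley, *Convergence of Probability Measures*, 2nd ed. (1999), Thm 2.1 (portmanteau)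
  [Billingsley1999].
-/

noncomputable section

open MeasureTheory Set Function Filter
open scoped ENNReal Topology

namespace Literature.Probability.Distributions

/-! ### The discrete coupling with maximal diagonal -/

section Discrete

variable {J : Type*} [Fintype J]

/-- **A coupling matrix of two probability vectors with maximal diagonal**: put the common mass
`m_j = min (p_j, q_j)` on the diagonal and spread the leftovers `p_j - m_j`, `q_{j'} - m_{j'}`
proportionally (product form, normalised by the total leftover `r = Σ (p - m) = Σ (q - m)`;
`r = 0` means `p = q` and the matrix is diagonal). [folklore] -/
def diagCouplingMatrix [DecidableEq J] (p q : J → ℝ) (j j' : J) : ℝ :=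
  (if j = j' then min (p j) (q j) else 0) +
    (p j - min (p j) (q j)) * (q j' - min (p j') (q j')) / ∑ i, (p i - min (p i) (q i))

variable {p q : J → ℝ}

/-- The total leftovers on both sides agree when `Σ p = Σ q`. [folklore] -/
theorem sum_sub_min_eq (h : ∑ j, p j = ∑ j, q j) :
    ∑ i, (p i - min (p i) (q i)) = ∑ i, (q i - min (p i) (q i)) := by
  simp only [Finset.sum_sub_distrib, h]

variable [DecidableEq J]

/-- The entries of the coupling matrix of nonnegative vectors are nonnegative. [folklore] -/
theorem diagCouplingMatrix_nonneg (hp : ∀ j, 0 ≤ p j) (hq : ∀ j, 0 ≤ q j) (j j' : J) :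
    0 ≤ diagCouplingMatrix p q j j' := by
  unfold diagCouplingMatrix
  refine add_nonneg ?_ (div_nonneg (mul_nonneg ?_ ?_) ?_)
  · split_ifs
    · exact le_min (hp j) (hq j)
    · exact le_rfl
  · exact sub_nonneg.2 (min_le_left _ _)
  · exact sub_nonneg.2 (min_le_right _ _)
  · exact Finset.sum_nonneg fun i _ ↦ sub_nonneg.2 (min_le_left _ _)

/-- The diagonal entry dominates the common mass `min (p_j, q_j)`. [folklore] -/
theorem min_le_diagCouplingMatrix_self (j : J) : min (p j) (q j) ≤ diagCouplingMatrix p q j j := by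
  unfold diagCouplingMatrix
  rw [if_pos rfl]
  refine le_add_of_nonneg_right (div_nonneg (mul_nonneg ?_ ?_) ?_)
  · exact sub_nonneg.2 (min_le_left _ _)
  · exact sub_nonneg.2 (min_le_right _ _)
  · exact Finset.sum_nonneg fun i _ ↦ sub_nonneg.2 (min_le_left _ _)

/-- **Row sums**: `Σ_{j'} γ_{j j'} = p_j`. [folklore] -/
theorem sum_diagCouplingMatrix_right (h : ∑ j, p j = ∑ j, q j) (j : J) :
    ∑ j', diagCouplingMatrix p q j j' = p j := by
  unfold diagCouplingMatrix
  rw [Finset.sum_add_distrib, Finset.sum_ite_eq, if_pos (Finset.mem_univ _), ← Finset.sum_div,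
    ← Finset.mul_sum, ← sum_sub_min_eq h]
  set r := ∑ i, (p i - min (p i) (q i)) with hr
  rcases eq_or_ne r 0 with h0 | h0
  · -- no leftover: `p j = min (p j) (q j)`
    have hle : ∀ i, 0 ≤ p i - min (p i) (q i) := fun i ↦ sub_nonneg.2 (min_le_left _ _)
    have hpj : p j - min (p j) (q j) = 0 :=
      (Finset.sum_eq_zero_iff_of_nonneg (fun i _ ↦ hle i)).1 h0 j (Finset.mem_univ _)
    rw [h0, div_zero, add_zero]
    linarith
  · rw [mul_div_assoc, div_self h0, mul_one]
    ring

/-- **Column sums**: `Σ_j γ_{j j'} = q_{j'}`. [folklore] -/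
theorem sum_diagCouplingMatrix_left (h : ∑ j, p j = ∑ j, q j) (j' : J) :
    ∑ j, diagCouplingMatrix p q j j' = q j' := by
  unfold diagCouplingMatrix
  rw [Finset.sum_add_distrib, Finset.sum_ite_eq', if_pos (Finset.mem_univ _), ← Finset.sum_div,
    ← Finset.sum_mul]
  set r := ∑ i, (p i - min (p i) (q i)) with hr
  rcases eq_or_ne r 0 with h0 | h0
  · have hle : ∀ i, 0 ≤ q i - min (p i) (q i) := fun i ↦ sub_nonneg.2 (min_le_right _ _)
    have h0' : ∑ i, (q i - min (p i) (q i)) = 0 := by rw [← sum_sub_min_eq h]; exact h0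
    have hqj : q j' - min (p j') (q j') = 0 :=
      (Finset.sum_eq_zero_iff_of_nonneg (fun i _ ↦ hle i)).1 h0' j' (Finset.mem_univ _)
    rw [h0, div_zero, add_zero]
    linarith
  · rw [mul_comm, mul_div_assoc, div_self h0, mul_one]
    ring

/-- Entries are at most the row mass (for nonnegative vectors). [folklore] -/
theorem diagCouplingMatrix_le_left (hp : ∀ j, 0 ≤ p j) (hq : ∀ j, 0 ≤ q j) (h : ∑ j, p j = ∑ j, q j)
    (j j' : J) : diagCouplingMatrix p q j j' ≤ p j := by
  rw [← sum_diagCouplingMatrix_right h j]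
  exact Finset.single_le_sum (fun i _ ↦ diagCouplingMatrix_nonneg hp hq j i) (Finset.mem_univ j')

/-- Entries are at most the column mass (for nonnegative vectors). [folklore] -/
theorem diagCouplingMatrix_le_right (hp : ∀ j, 0 ≤ p j) (hq : ∀ j, 0 ≤ q j) (h : ∑ j, p j = ∑ j, q j)
    (j j' : J) : diagCouplingMatrix p q j j' ≤ q j' := by
  rw [← sum_diagCouplingMatrix_left h j']
  exact Finset.single_le_sum (fun i _ ↦ diagCouplingMatrix_nonneg hp hq i j') (Finset.mem_univ j)

end Discrete


/-! ### Finite partitions of probability spaces -/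

section Measure

variable {S S' : Type*} [MeasurableSpace S] [MeasurableSpace S']

/-- The masses of the cells of a finite measurable partition of a probability space sum to `1`.
[folklore] -/
theorem sum_measureReal_eq_one_of_iUnion_eq_univ (μ : Measure S) [IsProbabilityMeasure μ]
    {J : Type*} [Fintype J] {A : J → Set S} (hA : ∀ j, MeasurableSet (A j))
    (hAd : Pairwise (Disjoint on A)) (hAu : ⋃ j, A j = univ) : ∑ j, μ.real (A j) = 1 := by
  have h : ∑ j, μ (A j) = 1 := by
    rw [← measure_univ (μ := μ), ← hAu, measure_iUnion hAd hA, tsum_fintype]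
  simp only [measureReal_def, ← ENNReal.toReal_sum (fun j _ ↦ measure_ne_top μ (A j)), h,
    ENNReal.toReal_one]

/-- A finite sum of measures pushes forward termwise. [folklore] -/
theorem map_finsetSum {T : Type*} [MeasurableSpace T] {ι : Type*} (s : Finset ι) (m : ι → Measure S)
    {f : S → T} (hf : Measurable f) : (∑ i ∈ s, m i).map f = ∑ i ∈ s, (m i).map f := by
  rw [← Measure.mapₗ_apply_of_measurable hf, map_sum]
  exact Finset.sum_congr rfl fun i _ ↦ Measure.mapₗ_apply_of_measurable hf _

/-! ### The coupling along two finite partitions -/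

variable {J : Type*} [Fintype J] [DecidableEq J]

/-- **The coupling of `μ` and `ν` along the partitions `A`, `B`**: the mixture of the product
laws `μ(· | A_j) ⊗ ν(· | B_{j'})` with the weights of the coupling matrix of the cell masses
(written with the unnormalised restrictions and the weights
`γ_{j j'} · μ(A_j)⁻¹ · ν(B_{j'})⁻¹`). [folklore] -/
def partitionCoupling (μ : Measure S) (ν : Measure S') (A : J → Set S) (B : J → Set S') :
    Measure (S × S') :=
  ∑ jj : J × J, (ENNReal.ofReal (diagCouplingMatrix (fun j ↦ μ.real (A j)) (fun j ↦ ν.real (B j)) jj.1 jj.2) *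
      (μ (A jj.1))⁻¹ * (ν (B jj.2))⁻¹) • (μ.restrict (A jj.1)).prod (ν.restrict (B jj.2))

variable {μ : Measure S} {ν : Measure S'} [IsProbabilityMeasure μ] [IsProbabilityMeasure ν]
  {A : J → Set S} {B : J → Set S'}

omit [Fintype J] [DecidableEq J] in
/-- The cell masses are nonnegative. [folklore] -/
private theorem p_nonneg (μ : Measure S) (A : J → Set S) : ∀ j, 0 ≤ (fun j ↦ μ.real (A j)) j :=
  fun _ ↦ measureReal_nonneg

/-- Weight bookkeeping, first marginal: `γ_{j j'} μ(A_j)⁻¹ ν(B_{j'})⁻¹ · ν(B_{j'}) = γ_{j j'} μ(A_j)⁻¹`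
(if `ν(B_{j'}) = 0` then `γ_{j j'} ≤ q_{j'} = 0`). [folklore] -/
theorem weight_mul_right (hA : ∀ j, MeasurableSet (A j)) (hB : ∀ j, MeasurableSet (B j))
    (hAd : Pairwise (Disjoint on A)) (hBd : Pairwise (Disjoint on B)) (hAu : ⋃ j, A j = univ)
    (hBu : ⋃ j, B j = univ) (j j' : J) :
    ENNReal.ofReal (diagCouplingMatrix (fun j ↦ μ.real (A j)) (fun j ↦ ν.real (B j)) j j') *
        (μ (A j))⁻¹ * (ν (B j'))⁻¹ * ν (B j') =
      ENNReal.ofReal (diagCouplingMatrix (fun j ↦ μ.real (A j)) (fun j ↦ ν.real (B j)) j j') * (μ (A j))⁻¹ := by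
  have hsum : ∑ j, μ.real (A j) = ∑ j, ν.real (B j) := by
    rw [sum_measureReal_eq_one_of_iUnion_eq_univ μ hA hAd hAu,
      sum_measureReal_eq_one_of_iUnion_eq_univ ν hB hBd hBu]
  rcases eq_or_ne (ν (B j')) 0 with h0 | h0
  · have hγ : diagCouplingMatrix (fun j ↦ μ.real (A j)) (fun j ↦ ν.real (B j)) j j' = 0 :=
      le_antisymm ((diagCouplingMatrix_le_right (p_nonneg μ A) (p_nonneg ν B) hsum j j').trans_eq
        (by simp [measureReal_def, h0])) (diagCouplingMatrix_nonneg (p_nonneg μ A) (p_nonneg ν B) j j')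
    simp [hγ]
  · rw [mul_assoc, ENNReal.inv_mul_cancel h0 (measure_ne_top _ _), mul_one]

/-- Weight bookkeeping, second marginal. [folklore] -/
theorem weight_mul_left (hA : ∀ j, MeasurableSet (A j)) (hB : ∀ j, MeasurableSet (B j))
    (hAd : Pairwise (Disjoint on A)) (hBd : Pairwise (Disjoint on B)) (hAu : ⋃ j, A j = univ)
    (hBu : ⋃ j, B j = univ) (j j' : J) :
    ENNReal.ofReal (diagCouplingMatrix (fun j ↦ μ.real (A j)) (fun j ↦ ν.real (B j)) j j') *
        (μ (A j))⁻¹ * (ν (B j'))⁻¹ * μ (A j) =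
      ENNReal.ofReal (diagCouplingMatrix (fun j ↦ μ.real (A j)) (fun j ↦ ν.real (B j)) j j') * (ν (B j'))⁻¹ := by
  have hsum : ∑ j, μ.real (A j) = ∑ j, ν.real (B j) := by
    rw [sum_measureReal_eq_one_of_iUnion_eq_univ μ hA hAd hAu,
      sum_measureReal_eq_one_of_iUnion_eq_univ ν hB hBd hBu]
  rcases eq_or_ne (μ (A j)) 0 with h0 | h0
  · have hγ : diagCouplingMatrix (fun j ↦ μ.real (A j)) (fun j ↦ ν.real (B j)) j j' = 0 :=
      le_antisymm ((diagCouplingMatrix_le_left (p_nonneg μ A) (p_nonneg ν B) hsum j j').trans_eq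
        (by simp [measureReal_def, h0])) (diagCouplingMatrix_nonneg (p_nonneg μ A) (p_nonneg ν B) j j')
    simp [hγ]
  · rw [mul_assoc, mul_comm ((ν (B j'))⁻¹), ← mul_assoc, mul_assoc _ ((μ (A j))⁻¹),
      ENNReal.inv_mul_cancel h0 (measure_ne_top _ _), mul_one]

/-- **First marginal of the partition coupling is `μ`.** [folklore] -/
theorem map_fst_partitionCoupling (hA : ∀ j, MeasurableSet (A j)) (hB : ∀ j, MeasurableSet (B j))
    (hAd : Pairwise (Disjoint on A)) (hBd : Pairwise (Disjoint on B)) (hAu : ⋃ j, A j = univ)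
    (hBu : ⋃ j, B j = univ) : (partitionCoupling μ ν A B).map Prod.fst = μ := by
  have hsum : ∑ j, μ.real (A j) = ∑ j, ν.real (B j) := by
    rw [sum_measureReal_eq_one_of_iUnion_eq_univ μ hA hAd hAu,
      sum_measureReal_eq_one_of_iUnion_eq_univ ν hB hBd hBu]
  rw [partitionCoupling, map_finsetSum _ _ measurable_fst]
  simp only [Measure.map_smul, Measure.map_fst_prod, Measure.restrict_apply_univ, smul_smul]
  rw [Fintype.sum_prod_type]
  simp only [weight_mul_right hA hB hAd hBd hAu hBu]
  have hterm : ∀ j, ∑ j', (ENNReal.ofReal (diagCouplingMatrix (fun j ↦ μ.real (A j)) (fun j ↦ ν.real (B j)) j j') *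
      (μ (A j))⁻¹) • μ.restrict (A j) = μ.restrict (A j) := by
    intro j
    rw [← Finset.sum_smul, ← Finset.sum_mul,
      ← ENNReal.ofReal_sum_of_nonneg (fun j' _ ↦ diagCouplingMatrix_nonneg (p_nonneg μ A) (p_nonneg ν B) j j'),
      sum_diagCouplingMatrix_right hsum j, ofReal_measureReal]
    rcases eq_or_ne (μ (A j)) 0 with h0 | h0
    · rw [Measure.restrict_eq_zero.2 h0, smul_zero]
    · rw [ENNReal.mul_inv_cancel h0 (measure_ne_top _ _), one_smul]
  simp only [hterm]
  rw [← Measure.sum_fintype, ← Measure.restrict_iUnion hAd hA, hAu, Measure.restrict_univ]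

/-- **Second marginal of the partition coupling is `ν`.** [folklore] -/
theorem map_snd_partitionCoupling (hA : ∀ j, MeasurableSet (A j)) (hB : ∀ j, MeasurableSet (B j))
    (hAd : Pairwise (Disjoint on A)) (hBd : Pairwise (Disjoint on B)) (hAu : ⋃ j, A j = univ)
    (hBu : ⋃ j, B j = univ) : (partitionCoupling μ ν A B).map Prod.snd = ν := by
  have hsum : ∑ j, μ.real (A j) = ∑ j, ν.real (B j) := by
    rw [sum_measureReal_eq_one_of_iUnion_eq_univ μ hA hAd hAu,
      sum_measureReal_eq_one_of_iUnion_eq_univ ν hB hBd hBu]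
  rw [partitionCoupling, map_finsetSum _ _ measurable_snd]
  simp only [Measure.map_smul, Measure.map_snd_prod, Measure.restrict_apply_univ, smul_smul]
  rw [Fintype.sum_prod_type, Finset.sum_comm]
  simp only [weight_mul_left hA hB hAd hBd hAu hBu]
  have hterm : ∀ j', ∑ j, (ENNReal.ofReal (diagCouplingMatrix (fun j ↦ μ.real (A j)) (fun j ↦ ν.real (B j)) j j') *
      (ν (B j'))⁻¹) • ν.restrict (B j') = ν.restrict (B j') := by
    intro j'
    rw [← Finset.sum_smul, ← Finset.sum_mul,
      ← ENNReal.ofReal_sum_of_nonneg (fun j _ ↦ diagCouplingMatrix_nonneg (p_nonneg μ A) (p_nonneg ν B) j j'),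
      sum_diagCouplingMatrix_left hsum j', ofReal_measureReal]
    rcases eq_or_ne (ν (B j')) 0 with h0 | h0
    · rw [Measure.restrict_eq_zero.2 h0, smul_zero]
    · rw [ENNReal.mul_inv_cancel h0 (measure_ne_top _ _), one_smul]
  simp only [hterm]
  rw [← Measure.sum_fintype, ← Measure.restrict_iUnion hBd hB, hBu, Measure.restrict_univ]

/-- The partition coupling is a probability measure. [folklore] -/
theorem isProbabilityMeasure_partitionCoupling (hA : ∀ j, MeasurableSet (A j)) (hB : ∀ j, MeasurableSet (B j))
    (hAd : Pairwise (Disjoint on A)) (hBd : Pairwise (Disjoint on B)) (hAu : ⋃ j, A j = univ)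
    (hBu : ⋃ j, B j = univ) : IsProbabilityMeasure (partitionCoupling μ ν A B) := by
  refine ⟨?_⟩
  have h := map_fst_partitionCoupling hA hB hAd hBd hAu hBu (μ := μ) (ν := ν)
  have h' := congrArg (fun m : Measure S ↦ m univ) h
  simp only [Measure.map_apply measurable_fst MeasurableSet.univ, preimage_univ, measure_univ] at h'
  exact h'

/-- **The diagonal blocks carry at least the common mass `Σ_j min (μ(A_j), ν(B_j))`.** [folklore] -/
theorem le_partitionCoupling_iUnion_prod (hA : ∀ j, MeasurableSet (A j)) (hB : ∀ j, MeasurableSet (B j))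
    (hAd : Pairwise (Disjoint on A)) (hBd : Pairwise (Disjoint on B)) (hAu : ⋃ j, A j = univ)
    (hBu : ⋃ j, B j = univ) :
    ENNReal.ofReal (∑ j, min (μ.real (A j)) (ν.real (B j))) ≤ partitionCoupling μ ν A B (⋃ j, A j ×ˢ B j) := by
  have hsum : ∑ j, μ.real (A j) = ∑ j, ν.real (B j) := by
    rw [sum_measureReal_eq_one_of_iUnion_eq_univ μ hA hAd hAu,
      sum_measureReal_eq_one_of_iUnion_eq_univ ν hB hBd hBu]
  set γ := diagCouplingMatrix (fun j ↦ μ.real (A j)) (fun j ↦ ν.real (B j)) with hγ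
  -- each diagonal term contributes `γ j j`
  have hdiag : ∀ j, ENNReal.ofReal (γ j j) ≤
      ((ENNReal.ofReal (γ j j) * (μ (A j))⁻¹ * (ν (B j))⁻¹) • (μ.restrict (A j)).prod (ν.restrict (B j)))
        (⋃ i, A i ×ˢ B i) := by
    intro j
    refine le_trans ?_ (measure_mono (subset_iUnion (fun i ↦ A i ×ˢ B i) j))
    rw [Measure.smul_apply, Measure.prod_prod, Measure.restrict_apply_self, Measure.restrict_apply_self,
      smul_eq_mul]
    rcases eq_or_ne (μ (A j)) 0 with hμ0 | hμ0
    · have h0 : γ j j = 0 := le_antisymm ((diagCouplingMatrix_le_left (p_nonneg μ A) (p_nonneg ν B) hsum j j).trans_eq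
        (by simp [measureReal_def, hμ0])) (diagCouplingMatrix_nonneg (p_nonneg μ A) (p_nonneg ν B) j j)
      simp [h0]
    rcases eq_or_ne (ν (B j)) 0 with hν0 | hν0
    · have h0 : γ j j = 0 := le_antisymm ((diagCouplingMatrix_le_right (p_nonneg μ A) (p_nonneg ν B) hsum j j).trans_eq
        (by simp [measureReal_def, hν0])) (diagCouplingMatrix_nonneg (p_nonneg μ A) (p_nonneg ν B) j j)
      simp [h0]
    rw [mul_assoc, mul_assoc, ← mul_assoc ((ν (B j))⁻¹), mul_comm ((ν (B j))⁻¹), mul_assoc (μ (A j)),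
      ENNReal.inv_mul_cancel hν0 (measure_ne_top _ _), mul_one, ENNReal.inv_mul_cancel hμ0 (measure_ne_top _ _),
      mul_one]
  calc ENNReal.ofReal (∑ j, min (μ.real (A j)) (ν.real (B j)))
      = ∑ j, ENNReal.ofReal (min (μ.real (A j)) (ν.real (B j))) :=
        ENNReal.ofReal_sum_of_nonneg fun j _ ↦ le_min measureReal_nonneg measureReal_nonneg
    _ ≤ ∑ j, ENNReal.ofReal (γ j j) :=
        Finset.sum_le_sum fun j _ ↦ ENNReal.ofReal_le_ofReal
          (min_le_diagCouplingMatrix_self (p := fun j ↦ μ.real (A j)) (q := fun j ↦ ν.real (B j)) j)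
    _ ≤ ∑ j, ((ENNReal.ofReal (γ j j) * (μ (A j))⁻¹ * (ν (B j))⁻¹) •
          (μ.restrict (A j)).prod (ν.restrict (B j))) (⋃ i, A i ×ˢ B i) := Finset.sum_le_sum fun j _ ↦ hdiag j
    _ ≤ ∑ j, ∑ j', ((ENNReal.ofReal (γ j j') * (μ (A j))⁻¹ * (ν (B j'))⁻¹) •
          (μ.restrict (A j)).prod (ν.restrict (B j'))) (⋃ i, A i ×ˢ B i) :=
        Finset.sum_le_sum fun j _ ↦ Finset.single_le_sum (f := fun j' ↦
          ((ENNReal.ofReal (γ j j') * (μ (A j))⁻¹ * (ν (B j'))⁻¹) •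
            (μ.restrict (A j)).prod (ν.restrict (B j'))) (⋃ i, A i ×ˢ B i)) (fun _ _ ↦ bot_le)
          (Finset.mem_univ j)
    _ = partitionCoupling μ ν A B (⋃ j, A j ×ˢ B j) := by
        rw [partitionCoupling, Measure.finsetSum_apply, Fintype.sum_prod_type]

/-- **Coupling along finite partitions** (the elementary step of Strassen's theorem / of the
coupling form of weak convergence). For probability measures `μ` on `S`, `ν` on `S'` and finite
measurable partitions `(A_j)`, `(B_j)` indexed by the same finite set, there is a coupling `π`
of `μ` and `ν` (a probability measure on `S × S'` with marginals `μ`, `ν`) which puts the two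
coordinates in corresponding cells with probability at least the common mass
`Σ_j min (μ(A_j), ν(B_j))`, i.e. `π((⋃_j A_j × B_j)ᶜ) ≤ 1 - Σ_j min (μ(A_j), ν(B_j))`.
(Lindvall, *Lectures on the coupling method* (1992), §I.5, the `γ`-coupling of discrete
distributions, transported to the cells.) [folklore] -/
theorem exists_coupling_of_partition (μ : Measure S) (ν : Measure S') [IsProbabilityMeasure μ]
    [IsProbabilityMeasure ν] {J : Type*} [Fintype J] {A : J → Set S} {B : J → Set S'}
    (hA : ∀ j, MeasurableSet (A j)) (hB : ∀ j, MeasurableSet (B j)) (hAd : Pairwise (Disjoint on A))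
    (hBd : Pairwise (Disjoint on B)) (hAu : ⋃ j, A j = univ) (hBu : ⋃ j, B j = univ) :
    ∃ π : Measure (S × S'), IsProbabilityMeasure π ∧ π.map Prod.fst = μ ∧ π.map Prod.snd = ν ∧
      ENNReal.ofReal (∑ j, min (μ.real (A j)) (ν.real (B j))) ≤ π (⋃ j, A j ×ˢ B j) ∧
      π (⋃ j, A j ×ˢ B j)ᶜ ≤ ENNReal.ofReal (1 - ∑ j, min (μ.real (A j)) (ν.real (B j))) := by
  classical
  haveI := isProbabilityMeasure_partitionCoupling hA hB hAd hBd hAu hBu (μ := μ) (ν := ν)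
  have hle := le_partitionCoupling_iUnion_prod hA hB hAd hBd hAu hBu (μ := μ) (ν := ν)
  refine ⟨partitionCoupling μ ν A B, inferInstance, map_fst_partitionCoupling hA hB hAd hBd hAu hBu,
    map_snd_partitionCoupling hA hB hAd hBd hAu hBu, hle, ?_⟩
  have hmeas : MeasurableSet (⋃ j, A j ×ˢ B j) := MeasurableSet.iUnion fun j ↦ (hA j).prod (hB j)
  have hm1 : ∑ j, min (μ.real (A j)) (ν.real (B j)) ≤ 1 := by
    calc ∑ j, min (μ.real (A j)) (ν.real (B j)) ≤ ∑ j, μ.real (A j) :=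
          Finset.sum_le_sum fun j _ ↦ min_le_left _ _
      _ = 1 := sum_measureReal_eq_one_of_iUnion_eq_univ μ hA hAd hAu
  rw [prob_compl_eq_one_sub hmeas, ENNReal.ofReal_sub _ (Finset.sum_nonneg fun j _ ↦
    le_min measureReal_nonneg measureReal_nonneg), ENNReal.ofReal_one]
  exact tsub_le_tsub_left hle 1


/-- `ℝ≥0∞` form of the common mass: `Σ_j min (μ(A_j), ν(B_j))` as extended reals. [folklore] -/
theorem ofReal_sum_min_measureReal (μ : Measure S) (ν : Measure S') [IsFiniteMeasure μ] [IsFiniteMeasure ν]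
    {J : Type*} [Fintype J] (A : J → Set S) (B : J → Set S') :
    ENNReal.ofReal (∑ j, min (μ.real (A j)) (ν.real (B j))) = ∑ j, min (μ (A j)) (ν (B j)) := by
  rw [ENNReal.ofReal_sum_of_nonneg fun j _ ↦ le_min measureReal_nonneg measureReal_nonneg]
  refine Finset.sum_congr rfl fun j _ ↦ ?_
  rw [ENNReal.ofReal_mono.map_min, ofReal_measureReal, ofReal_measureReal]

/-- **Coupling along finite partitions, `ℝ≥0∞` form**: a coupling `π` of `μ` and `ν` with
`Σ_j min (μ(A_j), ν(B_j)) ≤ π(⋃_j A_j × B_j)`. [folklore] -/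
theorem exists_coupling_of_partition' (μ : Measure S) (ν : Measure S') [IsProbabilityMeasure μ]
    [IsProbabilityMeasure ν] {J : Type*} [Fintype J] {A : J → Set S} {B : J → Set S'}
    (hA : ∀ j, MeasurableSet (A j)) (hB : ∀ j, MeasurableSet (B j)) (hAd : Pairwise (Disjoint on A))
    (hBd : Pairwise (Disjoint on B)) (hAu : ⋃ j, A j = univ) (hBu : ⋃ j, B j = univ) :
    ∃ π : Measure (S × S'), IsProbabilityMeasure π ∧ π.map Prod.fst = μ ∧ π.map Prod.snd = ν ∧
      ∑ j, min (μ (A j)) (ν (B j)) ≤ π (⋃ j, A j ×ˢ B j) := by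
  obtain ⟨π, hπ, h1, h2, hle, -⟩ := exists_coupling_of_partition μ ν hA hB hAd hBd hAu hBu
  exact ⟨π, hπ, h1, h2, (ofReal_sum_min_measureReal μ ν A B).symm.trans_le hle⟩

end Measure

/-! ### Continuity-set partitions near a compact set (pseudo-emetric spaces) -/

section Partition

variable {S : Type*} [PseudoEMetricSpace S] [MeasurableSpace S] [OpensMeasurableSpace S]

/-- **Null-frontier thickenings** (pseudo-emetric version of Mathlib's
`exists_null_frontier_thickening`): the frontiers of the `r`-thickenings of a set are pairwise
disjoint, so at most countably many of them have positive measure. [folklore] -/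
theorem exists_null_frontier_thickening' (μ : Measure S) [SFinite μ] (s : Set S) {a b : ℝ}
    (hab : a < b) : ∃ r ∈ Ioo a b, μ (frontier (Metric.thickening r s)) = 0 := by
  have mbles : ∀ r : ℝ, MeasurableSet (frontier (Metric.thickening r s)) :=
    fun r ↦ isClosed_frontier.measurableSet
  have disjs := Metric.frontier_thickening_disjoint s
  have key := Measure.countable_meas_pos_of_disjoint_iUnion (μ := μ) mbles disjs
  have aux := measure_sdiff_null (s := Ioo a b) (Set.Countable.measure_zero key volume)
  have len_pos : 0 < ENNReal.ofReal (b - a) := by simp only [hab, ENNReal.ofReal_pos, sub_pos]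
  rw [← Real.volume_Ioo, ← aux] at len_pos
  simpa [Set.Nonempty] using nonempty_of_measure_ne_zero len_pos.ne'

omit [MeasurableSpace S] [OpensMeasurableSpace S] in
/-- Two points of the `r`-thickening of a singleton are at edistance `< 2r`. [folklore] -/
theorem edist_lt_of_mem_thickening_singleton {x y z : S} {r : ℝ}
    (hy : y ∈ Metric.thickening r ({x} : Set S)) (hz : z ∈ Metric.thickening r ({x} : Set S)) :
    edist y z < ENNReal.ofReal r + ENNReal.ofReal r := by
  rw [Metric.mem_thickening_iff_infEDist_lt, Metric.infEDist_singleton] at hy hz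
  calc edist y z ≤ edist y x + edist x z := edist_triangle _ _ _
    _ < ENNReal.ofReal r + ENNReal.ofReal r := by
        rw [edist_comm x z]
        exact ENNReal.add_lt_add hy hz

omit [MeasurableSpace S] [OpensMeasurableSpace S] in
/-- A point belongs to the `r`-thickening of itself for `r > 0`. [folklore] -/
theorem mem_thickening_singleton_self (x : S) {r : ℝ} (hr : 0 < r) : x ∈ Metric.thickening r ({x} : Set S) :=
  Metric.self_subset_thickening hr _ (mem_singleton x)

/-- The frontier of a finite union `⋃_{j < i} f j` lies in the union of the frontiers. [folklore] -/
theorem frontier_biUnion_lt_subset {X : Type*} [TopologicalSpace X] (f : ℕ → Set X) :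
    ∀ i : ℕ, frontier (⋃ j < i, f j) ⊆ ⋃ j < i, frontier (f j)
  | 0 => by simp
  | i + 1 => by
    rw [biUnion_lt_succ, biUnion_lt_succ]
    refine (frontier_union_subset _ _).trans (union_subset_union ?_ inter_subset_right)
    exact inter_subset_left.trans (frontier_biUnion_lt_subset f i)

/-- The frontier of the `i`-th disjointed set lies in the union of the frontiers of `f 0, …, f i`.
[folklore] -/
theorem frontier_disjointed_subset {X : Type*} [TopologicalSpace X] (f : ℕ → Set X) (i : ℕ) :
    frontier (disjointed f i) ⊆ ⋃ j < i + 1, frontier (f j) := by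
  have h : disjointed f i = f i ∩ (⋃ j < i, f j)ᶜ := by
    rw [disjointed_eq_inter_compl, compl_iUnion₂]
  rw [h, biUnion_lt_succ]
  refine (frontier_inter_subset _ _).trans (union_subset ?_ ?_)
  · exact inter_subset_left.trans subset_union_right
  · rw [frontier_compl]
    exact inter_subset_right.trans ((frontier_biUnion_lt_subset f i).trans subset_union_left)

/-- **A finite partition into small continuity sets covering a compact set.** For a finite
measure `μ`, a compact `K` and `η > 0` there are finitely many pairwise disjoint measurable sets
`C 0, …, C (n-1)` of edistance-diameter `< η`, covering `K`, whose frontiers and the frontier of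
whose union are `μ`-null (cells of a disjointified finite subcover of `K` by null-frontier
thickenings of points, radii in `(η/4, η/2)`). [folklore] -/
theorem exists_fine_nullFrontier_partition (μ : Measure S) [IsFiniteMeasure μ] {K : Set S}
    (hK : IsCompact K) {η : ℝ} (hη : 0 < η) :
    ∃ (n : ℕ) (C : ℕ → Set S), (∀ i, MeasurableSet (C i)) ∧ Pairwise (Disjoint on C) ∧
      (∀ i, n ≤ i → C i = ∅) ∧ K ⊆ ⋃ i < n, C i ∧
      (∀ i, ∀ y ∈ C i, ∀ z ∈ C i, edist y z < ENNReal.ofReal η) ∧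
      (∀ i, μ (frontier (C i)) = 0) ∧ μ (frontier (⋃ i < n, C i)) = 0 := by
  -- null-frontier thickenings of the points of `K`
  have hrad : ∀ x : S, ∃ r ∈ Ioo (η / 4) (η / 2), μ (frontier (Metric.thickening r ({x} : Set S))) = 0 :=
    fun x ↦ exists_null_frontier_thickening' μ {x} (by linarith)
  choose r hr hr0 using hrad
  -- finite subcover
  obtain ⟨t, ht⟩ := hK.elim_finite_subcover (fun x : K ↦ Metric.thickening (r x) ({(x : S)} : Set S))
    (fun _ ↦ Metric.isOpen_thickening) fun x hx ↦
      mem_iUnion.2 ⟨⟨x, hx⟩, mem_thickening_singleton_self x (by linarith [(hr x).1])⟩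
  -- enumerate the subcover
  set l := t.toList with hl
  set n := l.length with hn
  set f : ℕ → Set S := fun i ↦ if h : i < n then Metric.thickening (r (l[i])) ({((l[i] : K) : S)} : Set S) else ∅
    with hf
  have hf_of_lt : ∀ {i} (h : i < n), f i = Metric.thickening (r (l[i])) ({((l[i] : K) : S)} : Set S) :=
    fun h ↦ by simp [hf, h]
  have hf_of_le : ∀ {i}, n ≤ i → f i = ∅ := fun h ↦ by simp [hf, not_lt.2 h]
  have hfm : ∀ i, MeasurableSet (f i) := by
    intro i
    by_cases h : i < n
    · rw [hf_of_lt h]; exact Metric.isOpen_thickening.measurableSet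
    · rw [hf_of_le (not_lt.1 h)]; exact MeasurableSet.empty
  have hf0 : ∀ i, μ (frontier (f i)) = 0 := by
    intro i
    by_cases h : i < n
    · rw [hf_of_lt h]; exact hr0 _
    · rw [hf_of_le (not_lt.1 h), frontier_empty, measure_empty]
  have hcover : K ⊆ ⋃ i < n, f i := by
    intro x hx
    obtain ⟨y, hy, hxy⟩ := mem_iUnion₂.1 (ht hx)
    obtain ⟨i, hi, rfl⟩ := List.mem_iff_getElem.1 ((Finset.mem_toList).2 hy)
    exact mem_iUnion₂.2 ⟨i, hi, by rwa [hf_of_lt hi]⟩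
  refine ⟨n, disjointed f, fun i ↦ .disjointed hfm i, disjoint_disjointed f, fun i hi ↦ ?_, ?_, ?_, ?_, ?_⟩
  · exact subset_empty_iff.1 ((disjointed_subset f i).trans (hf_of_le hi).subset)
  · -- `⋃_{i<n} disjointed f i = ⋃_i disjointed f i = ⋃_i f i ⊇ K`
    have hU : ⋃ i < n, disjointed f i = ⋃ i, f i := by
      rw [← iUnion_disjointed (f := f)]
      refine subset_antisymm (iUnion₂_subset fun i _ ↦ subset_iUnion _ i) (iUnion_subset fun i ↦ ?_)
      by_cases h : i < n
      · exact subset_iUnion₂ (s := fun i _ ↦ disjointed f i) i h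
      · rw [subset_empty_iff.1 ((disjointed_subset f i).trans (hf_of_le (not_lt.1 h)).subset)]
        exact empty_subset _
    rw [hU]
    exact hcover.trans (iUnion₂_subset fun i _ ↦ subset_iUnion _ i)
  · intro i y hy z hz
    by_cases h : i < n
    · have hy' := disjointed_subset f i hy
      have hz' := disjointed_subset f i hz
      rw [hf_of_lt h] at hy' hz'
      refine (edist_lt_of_mem_thickening_singleton hy' hz').trans_le ?_
      rw [← ENNReal.ofReal_add (by linarith [(hr (l[i])).1]) (by linarith [(hr (l[i])).1])]
      exact ENNReal.ofReal_le_ofReal (by linarith [(hr (l[i])).2])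
    · exact absurd (disjointed_subset f i hy) (by rw [hf_of_le (not_lt.1 h)]; exact notMem_empty y)
  · intro i
    refine measure_mono_null (frontier_disjointed_subset f i) ?_
    exact (measure_biUnion_null_iff (Set.to_countable _)).2 fun j _ ↦ hf0 j
  · have hU : ⋃ i < n, disjointed f i = ⋃ i < n, f i := by
      refine subset_antisymm (iUnion₂_mono fun i _ ↦ disjointed_subset f i) ?_
      have h1 : ⋃ i < n, f i ⊆ ⋃ i, f i := iUnion₂_subset fun i _ ↦ subset_iUnion _ i
      rw [← iUnion_disjointed (f := f)] at h1
      refine h1.trans (iUnion_subset fun i ↦ ?_)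
      by_cases h : i < n
      · exact subset_iUnion₂ (s := fun i _ ↦ disjointed f i) i h
      · rw [subset_empty_iff.1 ((disjointed_subset f i).trans (hf_of_le (not_lt.1 h)).subset)]
        exact empty_subset _
    rw [hU]
    refine measure_mono_null (frontier_biUnion_lt_subset f n) ?_
    exact (measure_biUnion_null_iff (Set.to_countable _)).2 fun j _ ↦ hf0 j

end Partition

/-! ### The coupling form of weak convergence -/

section WeakConvergence

variable {S : Type*} [PseudoEMetricSpace S] [MeasurableSpace S] [OpensMeasurableSpace S]

/-- **Couplings from weak convergence** (the elementary form of Strassen's theorem; Dudley 2002,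
Thm 11.6.2 / Cor. 11.6.4 on separable spaces, here on a pseudo-emetric space relative to a
compact set). If the probability measures `μ_i` converge weakly to `μ` along `l`, then for every
compact `K` and `η > 0`, eventually along `l` there is a coupling `π` of `μ_i` and `μ` under
which the two coordinates are at edistance `≥ η` with probability at most `2 μ(Kᶜ) + η`.
Proof: partition into finitely many continuity cells of diameter `< η` covering `K`
(`exists_fine_nullFrontier_partition`) plus the remainder; by the portmanteau theorem
`μ_i(C) → μ(C)` for each cell, so eventually the common mass `Σ_C min (μ_i(C), μ(C))` exceeds
`μ(⋃ C) - η`; the coupling along the partition (`exists_coupling_of_partition'`) puts both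
coordinates in a common cell, or both in the remainder (mass `≤ μ(Kᶜ)`), off an event of
probability `≤ 1 - Σ min ≤ μ(Kᶜ) + η`. [folklore] -/
theorem exists_coupling_of_tendsto_of_isCompact {ι : Type*} {l : Filter ι}
    {μs : ι → ProbabilityMeasure S} {μ : ProbabilityMeasure S} (hlim : Tendsto μs l (𝓝 μ))
    {K : Set S} (hK : IsCompact K) {η : ℝ} (hη : 0 < η) :
    ∀ᶠ i in l, ∃ π : Measure (S × S), IsProbabilityMeasure π ∧
      π.map Prod.fst = (μs i : Measure S) ∧ π.map Prod.snd = (μ : Measure S) ∧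
      π {p | ENNReal.ofReal η ≤ edist p.1 p.2} ≤ 2 * (μ : Measure S) Kᶜ + ENNReal.ofReal η := by
  classical
  obtain ⟨n, C, hCm, hCd, hCn, hKC, hCsmall, hC0, hCU0⟩ :=
    exists_fine_nullFrontier_partition (μ : Measure S) hK hη
  -- the partition indexed by `Option (Fin n)`: the cells and the remainder
  set A : Option (Fin n) → Set S := fun o ↦ Option.elim o (⋃ i < n, C i)ᶜ fun k ↦ C k with hA
  have hAm : ∀ o, MeasurableSet (A o) := by
    rintro (_ | k)
    · exact (MeasurableSet.biUnion (Set.to_countable _) fun i _ ↦ hCm i).compl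
    · exact hCm k
  have hAd : Pairwise (Disjoint on A) := by
    rintro (_ | k) (_ | k') hne
    · exact absurd rfl hne
    · change Disjoint (⋃ i < n, C i)ᶜ (C k')
      exact disjoint_compl_left.mono_right (subset_iUnion₂ (s := fun i _ ↦ C i) (k' : ℕ) k'.2)
    · change Disjoint (C k) (⋃ i < n, C i)ᶜ
      exact disjoint_compl_right.mono_left (subset_iUnion₂ (s := fun i _ ↦ C i) (k : ℕ) k.2)
    · change Disjoint (C k) (C k')
      exact hCd fun h ↦ hne (congrArg some (Fin.ext h))
  have hAu : ⋃ o, A o = univ := by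
    refine eq_univ_of_forall fun x ↦ ?_
    by_cases hx : x ∈ ⋃ i < n, C i
    · obtain ⟨i, hi, hxi⟩ := mem_iUnion₂.1 hx
      exact mem_iUnion.2 ⟨some ⟨i, hi⟩, hxi⟩
    · exact mem_iUnion.2 ⟨none, hx⟩
  -- portmanteau: the masses of the cells converge
  have hcell : ∀ k : Fin n, Tendsto (fun i ↦ (μs i : Measure S) (C k)) l (𝓝 ((μ : Measure S) (C k))) :=
    fun k ↦ ProbabilityMeasure.tendsto_measure_of_null_frontier_of_tendsto' hlim (hC0 k)
  set a : ℝ≥0∞ := ∑ k : Fin n, (μ : Measure S) (C k) with ha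
  have hmin : Tendsto (fun i ↦ ∑ k : Fin n, min ((μs i : Measure S) (C k)) ((μ : Measure S) (C k))) l (𝓝 a) := by
    have h := tendsto_finsetSum (Finset.univ : Finset (Fin n))
      (fun k _ ↦ (hcell k).min (tendsto_const_nhds (x := (μ : Measure S) (C k))))
    simpa only [min_self] using h
  -- eventually the common mass of the cells is `≥ a - η`
  have hev : ∀ᶠ i in l, a ≤ ∑ k : Fin n, min ((μs i : Measure S) (C k)) ((μ : Measure S) (C k)) + ENNReal.ofReal η := by
    by_cases hle : a ≤ ENNReal.ofReal η
    · exact Eventually.of_forall fun i ↦ hle.trans le_add_self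
    · have hη' : (0 : ℝ≥0∞) < ENNReal.ofReal η := ENNReal.ofReal_pos.2 hη
      have ha_top : a ≠ ⊤ := by
        rw [ha]; exact ENNReal.sum_ne_top.2 fun k _ ↦ measure_ne_top _ _
      have hlt : a - ENNReal.ofReal η < a :=
        ENNReal.sub_lt_self ha_top (fun h0 ↦ hle (h0 ▸ bot_le)) hη'.ne'
      filter_upwards [hmin.eventually_const_lt hlt] with i hi
      exact (tsub_le_iff_right.1 hi.le)
  -- mass of the remainder
  have hrem : (μ : Measure S) (A none) ≤ (μ : Measure S) Kᶜ := measure_mono (compl_subset_compl.2 hKC)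
  have h1a : 1 - a ≤ (μ : Measure S) Kᶜ := by
    have hUnion : (μ : Measure S) (⋃ i < n, C i) = a := by
      have e : ⋃ i < n, C i = ⋃ k : Fin n, C k := by
        ext x; simp only [mem_iUnion, exists_prop]
        exact ⟨fun ⟨i, hi, hx⟩ ↦ ⟨⟨i, hi⟩, hx⟩, fun ⟨k, hx⟩ ↦ ⟨k, k.2, hx⟩⟩
      rw [e, measure_iUnion (f := fun k : Fin n ↦ C k) (fun k k' hne ↦ hCd (Fin.val_injective.ne hne))
        (fun k ↦ hCm k), tsum_fintype]
    rw [← hUnion, ← prob_compl_eq_one_sub (MeasurableSet.iUnion fun i ↦ MeasurableSet.iUnion fun _ ↦ hCm i)]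
    exact hrem
  filter_upwards [hev] with i hi
  obtain ⟨π, hπ, hfst, hsnd, hdiag⟩ :=
    exists_coupling_of_partition' (μs i : Measure S) (μ : Measure S) hAm hAm hAd hAd hAu hAu
  refine ⟨π, hπ, hfst, hsnd, ?_⟩
  -- the bad event: not in a common cell, or both in the remainder
  have hsub : {p : S × S | ENNReal.ofReal η ≤ edist p.1 p.2} ⊆ (⋃ o, A o ×ˢ A o)ᶜ ∪ A none ×ˢ A none := by
    intro p hp
    by_cases hmem : p ∈ ⋃ o, A o ×ˢ A o
    · obtain ⟨o, ho⟩ := mem_iUnion.1 hmem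
      rcases o with _ | k
      · exact Or.inr ho
      · exact absurd (hCsmall k p.1 ho.1 p.2 ho.2) (not_lt.2 hp)
    · exact Or.inl hmem
  have hD : MeasurableSet (⋃ o, A o ×ˢ A o) := MeasurableSet.iUnion fun o ↦ (hAm o).prod (hAm o)
  have hnone : π (A none ×ˢ A none) ≤ (μ : Measure S) Kᶜ := by
    calc π (A none ×ˢ A none) ≤ π (Prod.snd ⁻¹' A none) := measure_mono fun p hp ↦ hp.2
      _ = (μ : Measure S) (A none) := by rw [← Measure.map_apply measurable_snd (hAm none), hsnd]
      _ ≤ (μ : Measure S) Kᶜ := hrem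
  have hsum_le : ∑ k : Fin n, min ((μs i : Measure S) (C k)) ((μ : Measure S) (C k)) ≤
      ∑ o, min ((μs i : Measure S) (A o)) ((μ : Measure S) (A o)) := by
    rw [Fintype.sum_option]
    exact le_add_self
  calc π {p | ENNReal.ofReal η ≤ edist p.1 p.2}
      ≤ π (⋃ o, A o ×ˢ A o)ᶜ + π (A none ×ˢ A none) := (measure_mono hsub).trans (measure_union_le _ _)
    _ ≤ (1 - ∑ o, min ((μs i : Measure S) (A o)) ((μ : Measure S) (A o))) + (μ : Measure S) Kᶜ := by
        gcongr
        rw [prob_compl_eq_one_sub hD]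
        exact tsub_le_tsub_left hdiag 1
    _ ≤ (1 - a + ENNReal.ofReal η) + (μ : Measure S) Kᶜ := by
        gcongr
        calc 1 - ∑ o, min ((μs i : Measure S) (A o)) ((μ : Measure S) (A o))
            ≤ 1 - ∑ k : Fin n, min ((μs i : Measure S) (C k)) ((μ : Measure S) (C k)) :=
              tsub_le_tsub_left hsum_le 1
          _ ≤ 1 - a + ENNReal.ofReal η := by
              rw [tsub_le_iff_right]
              calc (1 : ℝ≥0∞) ≤ 1 - a + a := le_tsub_add
                _ ≤ 1 - a + (∑ k : Fin n, min ((μs i : Measure S) (C k)) ((μ : Measure S) (C k)) +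
                    ENNReal.ofReal η) := add_le_add_right hi _
                _ = 1 - a + ENNReal.ofReal η + ∑ k : Fin n, min ((μs i : Measure S) (C k)) ((μ : Measure S) (C k)) := by
                    ring
    _ ≤ (μ : Measure S) Kᶜ + ENNReal.ofReal η + (μ : Measure S) Kᶜ := by gcongr
    _ = 2 * (μ : Measure S) Kᶜ + ENNReal.ofReal η := by ring

/-- **Couplings from weak convergence to a tight limit**: if the weak limit `μ` gives mass
`≥ 1 - η` to some compact set, then eventually along `l` there is a coupling of `μ_i` and `μ`
under which the coordinates are at edistance `≥ η` with probability `≤ 3η`. [folklore] -/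
theorem exists_coupling_of_tendsto_of_le_compact {ι : Type*} {l : Filter ι}
    {μs : ι → ProbabilityMeasure S} {μ : ProbabilityMeasure S} (hlim : Tendsto μs l (𝓝 μ)) {η : ℝ}
    (hη : 0 < η) {K : Set S} (hK : IsCompact K) (hμK : (μ : Measure S) Kᶜ ≤ ENNReal.ofReal η) :
    ∀ᶠ i in l, ∃ π : Measure (S × S), IsProbabilityMeasure π ∧
      π.map Prod.fst = (μs i : Measure S) ∧ π.map Prod.snd = (μ : Measure S) ∧
      π {p | ENNReal.ofReal η ≤ edist p.1 p.2} ≤ 3 * ENNReal.ofReal η := by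
  filter_upwards [exists_coupling_of_tendsto_of_isCompact hlim hK hη] with i ⟨π, hπ, h1, h2, h3⟩
  refine ⟨π, hπ, h1, h2, h3.trans ?_⟩
  calc 2 * (μ : Measure S) Kᶜ + ENNReal.ofReal η ≤ 2 * ENNReal.ofReal η + ENNReal.ofReal η := by gcongr
    _ = 3 * ENNReal.ofReal η := by ring

end WeakConvergence

end Literature.Probability.Distributions

end
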